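import Literature.NumberTheory.EllipticCurves.PadicSigmaOddPrime
import Literature.NumberTheory.EllipticCurves.PadicSigmaVariableChangeProofs
import Literature.NumberTheory.EllipticCurves.FormalGroupDictionaryProofs
import Literature.NumberTheory.EllipticCurves.VariableChangePoints
import HarnessLib

/-!
# The Mazur–Tate sigma function and the sigma-formula `p`-adic height under a change of variables
# between two globally minimal models (cell bsd-rank2, crux I4loc `SchneiderOnDoorSubfamily` of
# route `CountingDoorF2AtThree`, line `valuation-class-at-three`, stub `stub_transport` — part 1/2)

Cell-side proof file (seat bsd-rank2-cd-transport; `--supports stmt-BirchSwinnertonDyer-19682`).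
The line's transport stub moves Schneider's non-degeneracy of the CANONICAL `3`-adic height
(`PAdicHeightData.IsCanonical`, the sigma-formula predicate of `CanonicalPAdicHeight.lean`) from the
family's integral model `a.curve` to every globally minimal model `C • a.curve`. The predicate is
built on the CHOSEN Mazur–Tate sigma series `padicSigma (W ⊗ ℚ_p)` and on the coordinates
(`den x(P)`, `z(P) = -x/y`), so its transport needs (this file):

* `padicEval_formalVariableChange_eq` — **`θ(z(P)) = z(P')`**: the isomorphism of formal groups
  `θ = formalVariableChange V vc` (`FormalGroupVariableChangeProofs.lean`) evaluated at the
  parameter of a point `P ∈ E₁(ℚ_p)` of a `p`-integral equation is the parameter of the image point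
  `P' = (u⁻²(x - r), u⁻³(y - s(x - r) - t))` (`w(z(P)) = -1/y`, `padicEval_formalW_eq`);
* `padicSigma_eq_of_variableChange`, `padicEval_padicSigma_eq_of_variableChange` — if a Mazur–Tate
  pair exists for `vc • V` and pairs of `V` are unique, THE sigma series of `V` is
  `u⁻¹ · σ_{vc • V} ∘ θ` (`IsMazurTateSigmaPair.of_variableChange`), hence
  `σ_V(z(P)) = u⁻¹ σ_{vc • V}(z(P'))`;
* over `ℚ`, for `W` globally minimal with good ordinary reduction at an odd `p` and `C = (±1, r, s,
  t)`, `r, s, t ∈ ℤ`, with a Mazur–Tate pair for `(C • W) ⊗ ℚ_p`: `padicSigmaAt_eq_of_pointEquiv`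
  (`σ_p(P) = u⁻¹ σ_p'(P')`, uniqueness `IsMazurTateSigmaPair.unique_of_good_ordinary_odd`) and
  **`canonicalPAdicHeight_pointEquiv`**: `ĥ_p^{C • W}(P') = ĥ_p^{W}(P)` for every `P ∈ W(ℚ)` in the
  kernel of reduction (`den (x - r) = den x`, `log_p(±σ) = log_p σ`).

Part 2 (`CountingDoorF2AtThreeSchneiderOnDoorSubfamilyTransport.lean`) pulls the canonical datum
back along `pointEquiv`, transports `SchneiderConjecture`, and states the corrected stub.

PARTITION: none — r_an ≥ 2, summit axis S0; TWIN (D-0056): n/a. B1 honesty: model-change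
bookkeeping for `p`-adic heights; no Selmer group, `L`-value or analytic rank is mentioned.

References: B. Mazur, J. Tate, Duke Math. J. 62 (1991) §3, Thm. 3.1 (functoriality of
`σ_{(E,ω)}`) [MazurTate1991]; B. Mazur, W. Stein, J. Tate, Doc. Math. Extra Vol. (2006) Thm. 1.3,
§1 eq. (1.1) [MazurSteinTate2006]; W. Stein, C. Wuthrich, Math. Comp. 82 (2013) §4.1 (4.1)
[SteinWuthrich2013]; J. H. Silverman, *AEC* (2009) III.1, IV.1, VII.1.3(b), VII.2.2
[SilvermanAEC2009]. Pure proof file: no definition, no named fact, no instance.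
-/

noncomputable section

set_option linter.dupNamespace false

open scoped Classical
open PowerSeries Literature.NumberTheory.EllipticCurves

namespace Summit.BirchSwinnertonDyer.BirchSwinnertonDyer.Theorems

/-! ### A. Over `ℚ_p`: the isomorphism `θ` of formal groups evaluated at a point of `E₁(ℚ_p)` -/

section Padic

variable {p : ℕ} [Fact p.Prime] (V : WeierstrassCurve ℚ_[p]) [hV : V.IsIntegral ℤ_[p]]
  (vc : WeierstrassCurve.VariableChange ℚ_[p])

/-- **`θ(z(P)) = z(P')`**: for a `p`-integral equation `V/ℚ_p`, a `p`-integral change of variables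
`vc = (u, r, s, t)` and a point `P = (x, y) ∈ V(ℚ_p)` of the kernel of reduction (`‖x‖ > 1`), the
isomorphism of formal groups `θ = formalVariableChange V vc` evaluated at the parameter
`z(P) = -x/y` is the parameter `z(P') = -x'/y'` of the image point
`P' = (u⁻²(x - r), u⁻³(y - s(x - r) - t))` on `vc • V` (`w(z(P)) = -1/y`, AEC IV.1.1(b)).
[cite: SilvermanAEC2009, VII.2.2] -/
theorem padicEval_formalVariableChange_eq (hu : ‖(vc.u : ℚ_[p])‖ ≤ 1) (hr : ‖vc.r‖ ≤ 1)
    (hs : ‖vc.s‖ ≤ 1) (ht : ‖vc.t‖ ≤ 1) {x y : ℚ_[p]} (heq : V.toAffine.Equation x y)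
    (hx : 1 < ‖x‖) :
    padicEval (V.formalVariableChange vc) (-x / y) = -(vc.toX x) / vc.toY x y := by
  obtain ⟨hy0, hz0, hz1, hw1, -⟩ := V.param_facts heq hx
  have hw := V.padicEval_formalW_eq heq hx
  have hW := V.isPadicInt_formalW
  have hts : ‖vc.t - vc.s * vc.r‖ ≤ 1 := by
    rw [← PadicInt.mem_subring_iff] at hr hs ht ⊢
    exact sub_mem ht (mul_mem hs hr)
  have hden : IsPadicInt (V.formalVariableChangeDenom vc) :=
    (IsPadicInt.one.add ((IsPadicInt.powerSeries_C hs).mul IsPadicInt.powerSeries_X)).add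
      ((IsPadicInt.powerSeries_C hts).mul hW)
  have hdeni : IsPadicInt (invOfUnit (V.formalVariableChangeDenom vc) 1) :=
    hden.invOfUnit_one (V.constantCoeff_formalVariableChangeDenom vc)
  have hnum : IsPadicInt (X - C vc.r * V.formalW) :=
    IsPadicInt.powerSeries_X.sub ((IsPadicInt.powerSeries_C hr).mul hW)
  -- evaluate the three factors
  have h1 : padicEval (C (vc.u : ℚ_[p]) * (X - C vc.r * V.formalW)) (-x / y) =
      (vc.u : ℚ_[p]) * (-x / y - vc.r * (-1 / y)) := by
    rw [padicEval_mul (IsPadicInt.powerSeries_C hu) hnum hz1, padicEval_C,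
      padicEval_sub IsPadicInt.powerSeries_X ((IsPadicInt.powerSeries_C hr).mul hW) hz1,
      padicEval_X, padicEval_mul (IsPadicInt.powerSeries_C hr) hW hz1, padicEval_C, hw]
  have h2 : padicEval (V.formalVariableChangeDenom vc) (-x / y) =
      1 + vc.s * (-x / y) + (vc.t - vc.s * vc.r) * (-1 / y) := by
    rw [WeierstrassCurve.formalVariableChangeDenom,
      padicEval_add (IsPadicInt.one.add ((IsPadicInt.powerSeries_C hs).mul IsPadicInt.powerSeries_X))
        ((IsPadicInt.powerSeries_C hts).mul hW) hz1,
      padicEval_add IsPadicInt.one ((IsPadicInt.powerSeries_C hs).mul IsPadicInt.powerSeries_X) hz1,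
      padicEval_one, padicEval_mul (IsPadicInt.powerSeries_C hs) IsPadicInt.powerSeries_X hz1,
      padicEval_C, padicEval_X, padicEval_mul (IsPadicInt.powerSeries_C hts) hW hz1, padicEval_C, hw]
  have h3 : padicEval (invOfUnit (V.formalVariableChangeDenom vc) 1) (-x / y) =
      (1 + vc.s * (-x / y) + (vc.t - vc.s * vc.r) * (-1 / y))⁻¹ := by
    rw [padicEval_eq_inv_of_mul_eq_one hden hdeni (V.formalVariableChangeDenom_mul_invOfUnit vc) hz1,
      h2]
  -- the denominator `y - s(x - r) - t` does not vanish: `‖s(x - r) + t‖ ≤ ‖x‖ < ‖y‖`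
  obtain ⟨-, hxy⟩ := V.norm_sq_eq_norm_cube heq hx
  have hD : y - vc.s * (x - vc.r) - vc.t ≠ 0 := by
    intro h0
    have hyeq : y = vc.s * (x - vc.r) + vc.t := by linear_combination h0
    have hxr : ‖x - vc.r‖ ≤ ‖x‖ := by
      rw [sub_eq_add_neg]
      refine (Padic.nonarchimedean _ _).trans (max_le le_rfl ?_)
      rw [norm_neg]; exact hr.trans hx.le
    have : ‖y‖ ≤ ‖x‖ := by
      rw [hyeq]
      refine (Padic.nonarchimedean _ _).trans (max_le ?_ (ht.trans hx.le))
      rw [norm_mul]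
      exact (mul_le_of_le_one_left (norm_nonneg _) hs).trans hxr
    exact absurd this (not_le.mpr hxy)
  rw [WeierstrassCurve.formalVariableChange_def, padicEval_mul
    ((IsPadicInt.powerSeries_C hu).mul hnum) hdeni hz1, h1, h3,
    WeierstrassCurve.VariableChange.toX_def, WeierstrassCurve.VariableChange.toY_def]
  have hu0 : (vc.u : ℚ_[p]) ≠ 0 := vc.u.ne_zero
  have hnum_eq : -x / y - vc.r * (-1 / y) = -(x - vc.r) / y := by
    field_simp
    ring
  have hden_eq : 1 + vc.s * (-x / y) + (vc.t - vc.s * vc.r) * (-1 / y) =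
      (y - vc.s * (x - vc.r) - vc.t) / y := by
    field_simp
    ring
  rw [hnum_eq, hden_eq, Units.val_inv_eq_inv_val, inv_div]
  field_simp

/-- **The chosen sigma series transports: `σ_V = u⁻¹ · σ_{vc • V} ∘ θ`.** If a Mazur–Tate pair
exists for `vc • V` (`vc` `p`-integral with `u ∈ ℤ_pˣ`) and Mazur–Tate pairs of `V` are unique,
then the tree's chosen sigma series of `V` (`WeierstrassCurve.padicSigma`) is the transport
`u⁻¹ · σ' ∘ θ` of the chosen sigma series `σ'` of `vc • V` (functoriality of the sigma function of
`(E, ω)`: `σ_{(E, λω)} = λ σ_{(E, ω)}`, `ω_V = u⁻¹ ω_{vc • V}`). [cite: MazurTate1991, Thm. 3.1]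
[cite: MazurSteinTate2006, Thm. 1.3] -/
theorem padicSigma_eq_of_variableChange (hu : ‖(vc.u : ℚ_[p])‖ = 1) (hr : ‖vc.r‖ ≤ 1)
    (hs : ‖vc.s‖ ≤ 1) (ht : ‖vc.t‖ ≤ 1)
    (hex' : ∃ σ' : ℚ_[p]⟦X⟧, ∃ c' : ℚ_[p], (vc • V).IsMazurTateSigmaPair σ' c')
    (huniq : ∀ ⦃σ₁ σ₂ : ℚ_[p]⟦X⟧⦄ ⦃c₁ c₂ : ℚ_[p]⦄, V.IsMazurTateSigmaPair σ₁ c₁ →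
      V.IsMazurTateSigmaPair σ₂ c₂ → σ₁ = σ₂) :
    V.padicSigma =
      C ((vc.u⁻¹ : ℚ_[p]ˣ) : ℚ_[p]) * (vc • V).padicSigma.subst (V.formalVariableChange vc) := by
  have h' := (vc • V).isMazurTateSigmaPair_padicSigma hex'
  have hT := h'.of_variableChange hu hr hs ht
  exact huniq (V.isMazurTateSigmaPair_padicSigma ⟨_, _, hT⟩) hT

/-- **`σ_V(z(P)) = u⁻¹ · σ_{vc • V}(z(P'))` at a point of the kernel of reduction**: evaluate
`σ_V = u⁻¹ · σ' ∘ θ` at `z(P) = -x/y` (`‖x‖ > 1`) and use `θ(z(P)) = z(P')`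
(`padicEval_formalVariableChange_eq`). [cite: MazurTate1991, Thm. 3.1]
[cite: MazurSteinTate2006, Thm. 1.3] -/
theorem padicEval_padicSigma_eq_of_variableChange (hu : ‖(vc.u : ℚ_[p])‖ = 1) (hr : ‖vc.r‖ ≤ 1)
    (hs : ‖vc.s‖ ≤ 1) (ht : ‖vc.t‖ ≤ 1)
    (hex' : ∃ σ' : ℚ_[p]⟦X⟧, ∃ c' : ℚ_[p], (vc • V).IsMazurTateSigmaPair σ' c')
    (huniq : ∀ ⦃σ₁ σ₂ : ℚ_[p]⟦X⟧⦄ ⦃c₁ c₂ : ℚ_[p]⦄, V.IsMazurTateSigmaPair σ₁ c₁ →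
      V.IsMazurTateSigmaPair σ₂ c₂ → σ₁ = σ₂)
    {x y : ℚ_[p]} (heq : V.toAffine.Equation x y) (hx : 1 < ‖x‖) :
    padicEval V.padicSigma (-x / y) =
      ((vc.u⁻¹ : ℚ_[p]ˣ) : ℚ_[p]) * padicEval (vc • V).padicSigma (-(vc.toX x) / vc.toY x y) := by
  obtain ⟨-, -, hz1, -, -⟩ := V.param_facts heq hx
  have hui : ‖((vc.u⁻¹ : ℚ_[p]ˣ) : ℚ_[p])‖ ≤ 1 := by
    rw [Units.val_inv_eq_inv_val, norm_inv, hu, inv_one]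
  have hθ := V.isPadicInt_formalVariableChange vc hu.le hr hs ht
  have hσ' : IsPadicInt (vc • V).padicSigma := isPadicInt_iff_coeff.mpr (vc • V).norm_coeff_padicSigma_le
  rw [padicSigma_eq_of_variableChange V vc hu hr hs ht hex' huniq,
    padicEval_mul (IsPadicInt.powerSeries_C hui)
      (hσ'.powerSeries_subst hθ (V.hasSubst_formalVariableChange vc)) hz1, padicEval_C,
    padicEval_subst hσ' hθ (V.constantCoeff_formalVariableChange vc) hz1,
    padicEval_formalVariableChange_eq V vc hu.le hr hs ht heq hx]

end Padic

/-! ### B. Over `ℚ`: two globally minimal models `W` and `C • W` (`u = ±1`, `r, s, t ∈ ℤ`) -/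

section Rat

open WeierstrassCurve

variable {p : ℕ} [Fact p.Prime]

/-- Base change to `ℚ_p` commutes with the change of variables (Mathlib `map_variableChange`).
[folklore] -/
theorem baseChange_padic_smul (W : WeierstrassCurve ℚ) (C : VariableChange ℚ) :
    (C • W).baseChange ℚ_[p] = (C.baseChange ℚ_[p]) • W.baseChange ℚ_[p] := by
  simp only [WeierstrassCurve.baseChange, VariableChange.baseChange, map_variableChange]

/-- The unit of the base-changed change of variables is the cast of `u`. [folklore] -/
theorem coe_u_baseChange_padic (C : VariableChange ℚ) :
    ((C.baseChange ℚ_[p]).u : ℚ_[p]) = ((C.u : ℚ) : ℚ_[p]) := by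
  simp [VariableChange.baseChange, VariableChange.map]

/-- The inverse unit of the base-changed change of variables is the cast of `u⁻¹`. [folklore] -/
theorem coe_u_inv_baseChange_padic (C : VariableChange ℚ) :
    (((C.baseChange ℚ_[p]).u⁻¹ : ℚ_[p]ˣ) : ℚ_[p]) = (((C.u⁻¹ : ℚˣ) : ℚ) : ℚ_[p]) := by
  simp [VariableChange.baseChange, VariableChange.map]

/-- The `r` of the base-changed change of variables is the cast of `r`. [folklore] -/
theorem r_baseChange_padic (C : VariableChange ℚ) : (C.baseChange ℚ_[p]).r = ((C.r : ℚ) : ℚ_[p]) := by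
  simp [VariableChange.baseChange, VariableChange.map]

/-- The `s` of the base-changed change of variables is the cast of `s`. [folklore] -/
theorem s_baseChange_padic (C : VariableChange ℚ) : (C.baseChange ℚ_[p]).s = ((C.s : ℚ) : ℚ_[p]) := by
  simp [VariableChange.baseChange, VariableChange.map]

/-- The `t` of the base-changed change of variables is the cast of `t`. [folklore] -/
theorem t_baseChange_padic (C : VariableChange ℚ) : (C.baseChange ℚ_[p]).t = ((C.t : ℚ) : ℚ_[p]) := by
  simp [VariableChange.baseChange, VariableChange.map]

/-- `x' = u⁻²(x - r)` commutes with the cast `ℚ → ℚ_p`. [folklore] -/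
theorem toX_baseChange_padic (C : VariableChange ℚ) (x : ℚ) :
    (C.baseChange ℚ_[p]).toX (x : ℚ_[p]) = ((C.toX x : ℚ) : ℚ_[p]) := by
  rw [VariableChange.toX_def, VariableChange.toX_def, coe_u_inv_baseChange_padic, r_baseChange_padic]
  push_cast
  ring

/-- `y' = u⁻³(y - s(x - r) - t)` commutes with the cast `ℚ → ℚ_p`. [folklore] -/
theorem toY_baseChange_padic (C : VariableChange ℚ) (x y : ℚ) :
    (C.baseChange ℚ_[p]).toY (x : ℚ_[p]) (y : ℚ_[p]) = ((C.toY x y : ℚ) : ℚ_[p]) := by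
  rw [VariableChange.toY_def, VariableChange.toY_def, coe_u_inv_baseChange_padic, r_baseChange_padic,
    s_baseChange_padic, t_baseChange_padic]
  push_cast
  ring

/-- **`σ_p(P) = u⁻¹ · σ_p'(P')` for two globally minimal models.** Let `W/ℚ` be globally minimal with
good ordinary reduction at the odd prime `p`, `C = (u, r, s, t)` a change of variables with
`u = ±1`, `r, s, t ∈ ℤ` such that a Mazur–Tate pair exists for `(C • W) ⊗ ℚ_p`. Then for every
`P = (x, y) ∈ W(ℚ)` in the kernel of reduction at `p`, the value `σ_p(z(P))` of THE sigma function
of `W ⊗ ℚ_p` is `u⁻¹` times the value `σ_p'(z(P'))` of THE sigma function of `(C • W) ⊗ ℚ_p` at the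
image point `P'` (uniqueness of the Mazur–Tate pair at an odd good ordinary prime,
`IsMazurTateSigmaPair.unique_of_good_ordinary_odd`, and `padicEval_padicSigma_eq_of_variableChange`).
[cite: MazurTate1991, Thm. 3.1] [cite: MazurSteinTate2006, Thm. 1.3] -/
theorem padicSigmaAt_eq_of_pointEquiv (W : WeierstrassCurve ℚ) [W.IsGloballyMinimal]
    (C : VariableChange ℚ) (hp2 : p ≠ 2) (hgood : W.HasGoodReductionAtPrime p)
    (hord : ¬ (p : ℤ) ∣ W.frobeniusTrace p)
    (hex' : ∃ σ' : ℚ_[p]⟦X⟧, ∃ c' : ℚ_[p], ((C • W).baseChange ℚ_[p]).IsMazurTateSigmaPair σ' c')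
    (hu : C.u = 1 ∨ C.u = -1) (hrst : ∃ r s t : ℤ, C.r = r ∧ C.s = s ∧ C.t = t)
    {x y : ℚ} (h : W.toAffine.Nonsingular x y) (hx : 1 < ‖(x : ℚ_[p])‖) :
    W.padicSigmaAt p (.some x y h) =
      (((C.u⁻¹ : ℚˣ) : ℚ) : ℚ_[p]) *
        (C • W).padicSigmaAt p (VariableChange.pointEquiv W C (.some x y h)) := by
  obtain ⟨r, s, t, hr, hs, ht⟩ := hrst
  have hvu : ‖((C.baseChange ℚ_[p]).u : ℚ_[p])‖ = 1 := by
    rw [coe_u_baseChange_padic]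
    rcases hu with hu | hu <;> simp [hu]
  have hvr : ‖(C.baseChange ℚ_[p]).r‖ ≤ 1 := by
    rw [r_baseChange_padic, hr, Rat.cast_intCast]; exact Padic.norm_int_le_one r
  have hvs : ‖(C.baseChange ℚ_[p]).s‖ ≤ 1 := by
    rw [s_baseChange_padic, hs, Rat.cast_intCast]; exact Padic.norm_int_le_one s
  have hvt : ‖(C.baseChange ℚ_[p]).t‖ ≤ 1 := by
    rw [t_baseChange_padic, ht, Rat.cast_intCast]; exact Padic.norm_int_le_one t
  have hex'' : ∃ σ' : ℚ_[p]⟦X⟧, ∃ c' : ℚ_[p],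
      ((C.baseChange ℚ_[p]) • W.baseChange ℚ_[p]).IsMazurTateSigmaPair σ' c' := by
    rw [← baseChange_padic_smul]; exact hex'
  have huniq : ∀ ⦃σ₁ σ₂ : ℚ_[p]⟦X⟧⦄ ⦃c₁ c₂ : ℚ_[p]⦄, (W.baseChange ℚ_[p]).IsMazurTateSigmaPair σ₁ c₁ →
      (W.baseChange ℚ_[p]).IsMazurTateSigmaPair σ₂ c₂ → σ₁ = σ₂ :=
    fun σ₁ σ₂ c₁ c₂ h₁ h₂ =>
      (IsMazurTateSigmaPair.unique_of_good_ordinary_odd W p hp2 hgood hord h₁ h₂).1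
  rw [padicSigmaAt_eq_padicEval, padicSigmaAt_eq_padicEval, VariableChange.pointEquiv_some,
    padicParam_some, padicParam_some,
    padicEval_padicSigma_eq_of_variableChange (W.baseChange ℚ_[p]) (C.baseChange ℚ_[p]) hvu hvr hvs
      hvt hex'' huniq (nonsingular_ratCast h).1 hx,
    baseChange_padic_smul, coe_u_inv_baseChange_padic, toX_baseChange_padic, toY_baseChange_padic]

/-- **The sigma-formula height is the same on two globally minimal models.** With `W`, `C`, `p`
as in `padicSigmaAt_eq_of_pointEquiv`, for every `P = (x, y) ∈ W(ℚ)` in the kernel of reduction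
at `p`: `ĥ_p^{C • W}(P') = ĥ_p^{W}(P)`, where
`ĥ_p(P) = log_p(den x(P)) - 2 log_p σ_p(z(P))` (`canonicalPAdicHeight`): `den x' = den (x - r)
= den x` (`r ∈ ℤ`, `u² = 1`), `σ_p'(P') = u σ_p(P)` and `log_p(±σ) = log_p σ`.
[cite: MazurSteinTate2006, §1 eq. (1.1)] [cite: SteinWuthrich2013, §4.1 eq. (4.1)] -/
theorem canonicalPAdicHeight_pointEquiv (W : WeierstrassCurve ℚ) [W.IsGloballyMinimal]
    (C : VariableChange ℚ) (hp2 : p ≠ 2) (hgood : W.HasGoodReductionAtPrime p)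
    (hord : ¬ (p : ℤ) ∣ W.frobeniusTrace p)
    (hex' : ∃ σ' : ℚ_[p]⟦X⟧, ∃ c' : ℚ_[p], ((C • W).baseChange ℚ_[p]).IsMazurTateSigmaPair σ' c')
    (hu : C.u = 1 ∨ C.u = -1) (hrst : ∃ r s t : ℤ, C.r = r ∧ C.s = s ∧ C.t = t)
    {x y : ℚ} (h : W.toAffine.Nonsingular x y) (hx : 1 < ‖(x : ℚ_[p])‖) :
    (C • W).canonicalPAdicHeight p (VariableChange.pointEquiv W C (.some x y h)) =
      W.canonicalPAdicHeight p (.some x y h) := by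
  have hσ := padicSigmaAt_eq_of_pointEquiv W C hp2 hgood hord hex' hu hrst h hx
  obtain ⟨r, s, t, hr, -, -⟩ := hrst
  have hui : (C.u⁻¹ : ℚˣ) = 1 ∨ (C.u⁻¹ : ℚˣ) = -1 := by
    rcases hu with hu | hu
    · left; rw [hu, inv_one]
    · right; rw [hu, inv_neg, inv_one]
  -- the denominator
  have hden : (C.toX x).den = x.den := by
    rw [VariableChange.toX_def, hr]
    have h2 : ((C.u⁻¹ : ℚˣ) : ℚ) ^ 2 = 1 := by
      rcases hui with h1 | h1 <;> simp [h1]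
    rw [h2, one_mul, Rat.sub_intCast_den]
  -- the sigma values
  have hσne : W.padicSigmaAt p (.some x y h) ≠ 0 := W.padicSigmaAt_ne_zero p hp2 h hx
  rw [VariableChange.pointEquiv_some] at hσ ⊢
  rw [canonicalPAdicHeight_some, canonicalPAdicHeight_some, hden]
  congr 2
  rcases hui with h1 | h1
  · rw [hσ, h1]; simp
  · rw [h1] at hσ
    have hσ' : (C • W).padicSigmaAt p (.some (C.toX x) (C.toY x y)
        ((VariableChange.nonsingular_iff W C x y).mpr h)) = -W.padicSigmaAt p (.some x y h) := by
      rw [hσ]; push_cast; ring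
    rw [hσ', padicLog_neg hσne]

end Rat

end Summit.BirchSwinnertonDyer.BirchSwinnertonDyer.Theorems

end
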